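import Literature.IUT.HodgeTheaters.InitialThetaDataBadLocalFrobenioid
import Literature.IUT.HodgeArakelov.KummerStructures
import Mathlib.FieldTheory.Galois.Infinite
import HarnessLib

/-!
# The `G_v`-monoids `𝒪^▷_{K̄_v} ⊇ 𝒪^×_{K̄_v}·q̲_v^ℕ` of the GENUINE `p_v`-adic Frobenioids `C_v ⊇ C⊢_v` of [IUTchI]
# Ex. 3.2/3.3 «evaluated at the universal covering pro-object», as [IUTchII] Def. 4.9 (i) covering monoids
# (junction L5 × L6: MERGE-MAP row B16 (i))

Mochizuki, *Inter-universal Teichmüller Theory I*, kurims manuscript (May 2020), Ex. 3.2 (iv) p. 71 «`q_v ∈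
𝒪^▷(T_{X̲̲_v}) (≅ 𝒪^▷_{K_v})` … `Φ_{C⊢_v} := ℕ·log_Φ(q̲_v)|_{D⊢_v}` … `C⊢_v`», (v) p. 72 «`𝒪^▷_{C^Θ_v}(−) = 𝒪^×_{C^Θ_v}(−)·
Θ̲_v^ℕ`», Ex. 3.3 (i) p. 78 «`D⊢_v := B(K_v)⁰` … the `p_v`-adic Frobenioid `C_v`» [cite: Mochizuki2012, I Ex 3.2 (iv)(v)
pp.71-72]; *… II*, Def. 4.9 (i) p. 154 «write `G` for Aut of a universal covering pro-object `A` of `D` … the monoid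
`𝒪^▷(A)` equipped with a natural action by `G` … obtained by evaluating the monoid `𝒪^▷(−)` on `D` at `A`», Prop. 3.1
p. 87 / Def. 3.8 (i) p. 101 (the constant / split monoids `𝒪^×·q̲^ℕ` at `v ∈ V^bad`) [cite: Mochizuki2012, II Def 4.9 (i)
p.154] (D-0012 claim key, status disputed; nothing of the series is asserted); [FrdII] Ex. 1.1 (i) p. 7 («`Spec K ↦
𝒪^▷_K`», «`ord(𝒪^▷_K) := 𝒪^▷_K/𝒪^×_K`») [cite: MochizukiFrdII2008, Ex 1.1 (i) p.7].

Cell abc-iut, seat abc-iut-L5-t2 (gen 7); row «B16-i COVERING-MONOID-AT-GENUINE-CDASH» (abc-iut-L6-t7 MERGE-MAP v39 §B16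
(i) «`CoveringMonoid G_v` at the genuine `C⊢_v̲` … the only kernel content»; GO abc-iut-L5-lead 15:00:04Z (2); WAKE trigger
of record «L6 consumer request over `InitialThetaData.badLocalFrobenioidAt`»).  DEF-BEARING junction, class (b) (defs
over existing interfaces; 0 instances / notation / `Prop` facts; nothing landed is edited).  Consumed BY NAME: abc-iut-L6-t2's
INTERFACE `Literature.IUT.HodgeArakelov.CoveringMonoid G` ([IUTchII] Def. 4.9 (i), `KummerStructures.lean`, whose
docstring names this lineage as owner of the merge), abc-iut-L5-t2's `GaloisValDatum` (`K_v`, `Ω = K̄_v` valued,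
`G_v = Gal(Ω/K_v)`, `val_aut`) with its field functor `Spec Ω^U ↦ Ω^U` of `D⊢_v = B(K_v)⁰ = CosetCat G_v`
(`GaloisCosetFields.lean`: `fixedFld`, `valOn`, `fixedHom` — the [FrdII] base of the genuine `C_v`, `C⊢_v̲`), abc-iut-L1's
`PadicFrd.intNonzero` («`𝒪^▷_K`») / `intNonzeroMap` / `isUnit_intNonzero_iff`, abc-iut-L5-t2's `InitialThetaData.qRootAt`
(the genuine `q̲_v̲ ∈ 𝒪^▷_{K_v̲}`, p442528) and Mathlib's infinite Galois theory (Krull topology,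
`InfiniteGalois.mem_range_algebraMap_iff_fixed`, `IntermediateField.fixingSubgroup_isOpen`).

WHAT THIS FILE CONSTRUCTS / PROVES (for every `d : GaloisValDatum p`):
* `d.galAct : G_v →* MulAut 𝒪^▷_{K̄_v}` — `Gal(Ω/K_v)` acts on `𝒪^▷_Ω := intNonzero Ω` by monoid automorphisms
  (`val_aut`: `σ` preserves «valuation `≤ 1`»); **`d.coveringMonoid : CoveringMonoid G_v`** — the `G_v`-monoid `𝒪^▷_{K̄_v}`,
  i.e. the monoid `𝒪^▷(−)` of the `p_v`-adic Frobenioid `C_v` of `K_v` ([IUTchI] Ex. 3.3 (i) at `v ∈ V^good ∩ V^non`; the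
  base-field-theoretic hull `C_v` at `v ∈ V^bad`) EVALUATED AT THE UNIVERSAL COVERING: the three facts that make
  `𝒪^▷_Ω` the direct limit of `U ↦ 𝒪^▷(T_{G/U}) = 𝒪^▷_{Ω^U}` along the canonical pro-object `(G/U)_{U open}` —
  (lim-1) `galAct_fixed_iff_exists_fixedFld`: the `U`-invariants of `𝒪^▷_Ω` are EXACTLY the nonzero integers of the field
  `Ω^U` of the object `G/U` of `D⊢_v` with its restricted valuation `valOn` (the one the Frobenioid uses);
  (lim-2) `exists_open_forall_galAct_eq`: every element of `𝒪^▷_Ω` is invariant under some OPEN `U` (it comes from the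
  object `Spec K_v(x)`); (lim-3) `galAct_fixedHom`: the Frobenioid's restriction map along `G/U → G/V` with point `g·V`
  (`fixedHom`, `x ↦ g·x`) is the action of `g` — the cocone commutes up to `G_v`, which is print's «natural action by
  `G = Aut(A)`»; plus `forall_galAct_eq_iff_exists_base` (the `G_v`-invariants are `𝒪^▷_{K_v}`) and `isUnit_galAct_iff`.
* **`d.dashCoveringMonoid q : CoveringMonoid G_v`** — the `G_v`-STABLE submonoid `𝒪^×_{K̄_v}·q^ℕ ⊆ 𝒪^▷_{K̄_v}` for
  `q ∈ 𝒪^▷_{K_v}`: the monoid `𝒪^▷(−)` of the GENUINE `C⊢_v` (`Φ_{C⊢_v} = ℕ·log_Φ(q̲_v)`: over `Spec L` its Frobenius-trivial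
  object has `𝒪^▷(T_L) = 𝒪^×_L·q̲_v^ℕ`) evaluated at the universal covering; `toΩ_mem_dashCovering` (`q̲` itself),
  `galAct_toΩ` (`q̲` is `G_v`-fixed), `dashCovering_le` (⊆ `𝒪^▷`), units = `𝒪^×_{K̄_v}`.
* AT THE DATUM (`InitialThetaData D`, `v̲ = w ∣ v ∈ V(F)^bad`, `p` under `w`): **`D.badCoveringMonoidAt hv w p hw`** — the
  `Gal(K̄_w/K_w)`-monoid `𝒪^×_{K̄_w}·q̲_v̲^ℕ` of the GENUINE `C⊢_v̲ = D.badCdashAt` (p442528), with `qRootAt_mem_badCoveringMonoidAt`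
  / `galAct_qRootAt` (the genuine `q̲_v̲` is a `G_v̲`-invariant element); the hull's monoid is
  `(GaloisValDatum.ofPlace K p w hw).coveringMonoid`.
NOT DONE HERE (named follow-ups): the objectwise isomorphism of `PadicFrd.Datum.effSubmonoid` (abc-iut-L5-t2 p440826) of
the [FrdII] data `GaloisValDatum.dashDatum` / the full datum with the stages above (unpacking L1's fibre-product `B`), and
the equality «valuation after `σ` = valuation» on all of `Ω` (only «`≤ 1` iff» is needed and used).  HONEST FRAMING:
pure valuation/Galois theory over Mathlib and the tree's interfaces; nothing asserts that a `CoveringMonoid` so obtained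
carries a Kummer structure; [IUTchI]/[IUTchII] are disputed and nothing of them is asserted; no side taken on [IUTchIII]
Cor. 3.12; typed ≠ proved for anything else.
-/

noncomputable section

open scoped Classical

namespace Literature.IUT.HodgeTheaters

open CategoryTheory NumberField IsDedekindDomain Literature.AnabelianGeometry.SemiGraphs
  Literature.AlgebraicGeometry.Frobenioids Literature.AlgebraicGeometry.Frobenioids.PadicFrd
  Literature.IUT.HodgeArakelov

universe u

namespace GaloisValDatum

variable {p : ℕ} [Fact p.Prime] (d : GaloisValDatum.{u} p)

/-! ### `G_v = Gal(K̄_v/K_v)` acts on `𝒪^▷_{K̄_v}` -/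

/-- `Gal(Ω/K_v)` preserves «valuation `≤ 1`» on `Ω` (`val_aut` at `(x, 1)`). [cite: MochizukiFrdII2008, Ex 1.1 (i) p.7] -/
theorem valuation_gal_le_one_iff (σ : d.Gal) (x : d.Ω) :
    ValuativeRel.valuation d.Ω (σ x) ≤ 1 ↔ ValuativeRel.valuation d.Ω x ≤ 1 := by
  have h := d.val_aut σ x 1
  rw [map_one, Valuation.Compatible.vle_iff_le (v := ValuativeRel.valuation d.Ω),
    Valuation.Compatible.vle_iff_le (v := ValuativeRel.valuation d.Ω), map_one] at h
  exact h

/-- `Gal(Ω/K_v)` maps `𝒪^▷_Ω` into itself. [cite: MochizukiFrdII2008, Ex 1.1 (i) p.7] -/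
theorem gal_mem_intNonzero (σ : d.Gal) {x : d.Ω} (hx : x ∈ intNonzero d.Ω) : σ x ∈ intNonzero d.Ω :=
  ⟨(d.valuation_gal_le_one_iff σ x).mpr hx.1, (map_ne_zero_iff σ σ.injective).mpr hx.2⟩

/-- The action of one `σ ∈ Gal(Ω/K_v)` on `𝒪^▷_Ω`, as a monoid automorphism. [cite: Mochizuki2012, II Def 4.9 (i) p.154] -/
def galActAut (σ : d.Gal) : MulAut ↥(intNonzero d.Ω) where
  toFun x := ⟨σ x, d.gal_mem_intNonzero σ x.2⟩
  invFun x := ⟨σ.symm x, d.gal_mem_intNonzero σ.symm x.2⟩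
  left_inv x := Subtype.ext (σ.symm_apply_apply (x : d.Ω))
  right_inv x := Subtype.ext (σ.apply_symm_apply (x : d.Ω))
  map_mul' x y := Subtype.ext (by
    change σ ((x : d.Ω) * y) = σ x * σ y
    exact map_mul σ _ _)

/-- Values of `galActAut`. [cite: Mochizuki2012, II Def 4.9 (i) p.154] -/
@[simp] theorem coe_galActAut_apply (σ : d.Gal) (x : intNonzero d.Ω) :
    ((d.galActAut σ x : intNonzero d.Ω) : d.Ω) = σ x := rfl

/-- **`G_v →* Aut(𝒪^▷_{K̄_v})`, the natural action** («the monoid `𝒪^▷(A)` equipped with a natural action by `G`»).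
[cite: Mochizuki2012, II Def 4.9 (i) p.154] -/
def galAct : d.Gal →* MulAut ↥(intNonzero d.Ω) where
  toFun := d.galActAut
  map_one' := MulEquiv.ext fun _ => Subtype.ext rfl
  map_mul' _ _ := MulEquiv.ext fun _ => Subtype.ext rfl

/-- Values of `galAct`: `(σ · x) = σ x` in `Ω`. [cite: Mochizuki2012, II Def 4.9 (i) p.154] -/
@[simp] theorem coe_galAct_apply (σ : d.Gal) (x : intNonzero d.Ω) :
    ((d.galAct σ x : intNonzero d.Ω) : d.Ω) = σ x := rfl

/-- **The `G_v`-monoid `𝒪^▷_{K̄_v}`** — the monoid `𝒪^▷(−)` of the `p_v`-adic Frobenioid `C_v` of `K_v` evaluated at the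
universal covering pro-object of `D⊢_v = B(K_v)⁰`, with its natural `G_v = Gal(K̄_v/K_v)`-action, as abc-iut-L6-t2's
[IUTchII] Def. 4.9 (i) interface `CoveringMonoid G_v`. [cite: Mochizuki2012, II Def 4.9 (i) p.154] -/
def coveringMonoid : CoveringMonoid.{u, u} d.Gal where
  O := ↥(intNonzero d.Ω)
  act := d.galAct

/-- The carrier and action of `coveringMonoid` (bookkeeping). [cite: Mochizuki2012, II Def 4.9 (i) p.154] -/
theorem coveringMonoid_O_act : d.coveringMonoid.O = ↥(intNonzero d.Ω) ∧ d.coveringMonoid.act = d.galAct := ⟨rfl, rfl⟩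

/-! ### «Evaluated at the universal covering»: invariants, exhaustion, and the restriction maps -/

/-- An element of `𝒪^▷_Ω` is fixed by `σ` iff its underlying element of `Ω` is. [cite: Mochizuki2012, II Def 4.9 (i) p.154] -/
theorem galAct_eq_iff (σ : d.Gal) (x : intNonzero d.Ω) : d.galAct σ x = x ↔ σ (x : d.Ω) = x :=
  ⟨fun h => congrArg Subtype.val h, fun h => Subtype.ext h⟩

/-- **(lim-1) the `U`-invariants of `𝒪^▷_{K̄_v}` are the nonzero integers of `Ω^U`**: for an object `G/U` of `D⊢_v`, an
element of `𝒪^▷_Ω` is `U`-invariant iff it is (the image of) an element of `𝒪^▷_{Ω^U}` — the monoid «`𝒪^▷`» of the field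
`Ω^U = K_{G/U}` over which `G/U` lies, with the valuation the Frobenioid uses (`valOn`, the restriction of that of `Ω`).
[cite: MochizukiFrdII2008, Ex 1.1 (i) p.7] -/
theorem galAct_fixed_iff_exists_fixedFld (X : CosetCat d.Gal) (x : intNonzero d.Ω) :
    (∀ σ ∈ X.sg, d.galAct σ x = x) ↔
      ∃ y : d.fixedFld X, y ∈ @intNonzero (d.fixedFld X) _ (d.valOn (d.fixedFld X)) ∧ (y : d.Ω) = x := by
  letI := d.valOn (d.fixedFld X)
  constructor
  · intro h
    have hx : (x : d.Ω) ∈ d.fixedFld X :=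
      (IntermediateField.mem_fixedField_iff _ _).mpr fun σ hσ => (d.galAct_eq_iff σ x).mp (h σ hσ)
    refine ⟨⟨x, hx⟩, ⟨?_, fun h0 => x.2.2 (congrArg Subtype.val h0)⟩, rfl⟩
    rw [← (ValuativeRel.valuation (d.fixedFld X)).map_one, ← Valuation.Compatible.vle_iff_le, d.valOn_iff,
      OneMemClass.coe_one, Valuation.Compatible.vle_iff_le (v := ValuativeRel.valuation d.Ω), map_one]
    exact x.2.1
  · rintro ⟨y, -, hyx⟩ σ hσ
    rw [galAct_eq_iff, ← hyx]
    exact (IntermediateField.mem_fixedField_iff _ _).mp y.2 σ hσ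

/-- **(lim-2) exhaustion: every element of `𝒪^▷_{K̄_v}` is invariant under some OPEN subgroup**, i.e. comes from the
stage `𝒪^▷(T_{G/U})` of some object of `D⊢_v` (`U := Gal(Ω/K_v(x))`, open since `K_v(x)/K_v` is finite).
[cite: Mochizuki2012, II Def 4.9 (i) p.154] -/
theorem exists_open_forall_galAct_eq (x : intNonzero d.Ω) :
    ∃ X : CosetCat d.Gal, ∀ σ ∈ X.sg, d.galAct σ x = x := by
  haveI : FiniteDimensional d.k (IntermediateField.adjoin d.k {(x : d.Ω)}) :=
    IntermediateField.adjoin.finiteDimensional (Algebra.IsSeparable.isIntegral d.k (x : d.Ω))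
  refine ⟨⟨⟨(IntermediateField.adjoin d.k {(x : d.Ω)}).fixingSubgroup,
    IntermediateField.fixingSubgroup_isOpen _⟩⟩, fun σ hσ => ?_⟩
  rw [galAct_eq_iff]
  exact (IntermediateField.mem_fixingSubgroup_iff _ _).mp hσ _ (IntermediateField.mem_adjoin_simple_self d.k _)

/-- **The `G_v`-invariants of `𝒪^▷_{K̄_v}` are `𝒪^▷_{K_v}`** (`Ω^{G_v} = K_v`, infinite Galois theory; the valuation of `Ω`
extends that of `K_v`). [cite: MochizukiFrdII2008, Ex 1.1 (i) p.7] -/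
theorem forall_galAct_eq_iff_exists_base (x : intNonzero d.Ω) :
    (∀ σ : d.Gal, d.galAct σ x = x) ↔ ∃ a : intNonzero d.k, intNonzeroMap d.Ω d.k a = x := by
  constructor
  · intro h
    obtain ⟨a, ha⟩ := (InfiniteGalois.mem_range_algebraMap_iff_fixed (x : d.Ω)).mpr
      fun σ => (d.galAct_eq_iff σ x).mp (h σ)
    have ha' : a ∈ intNonzero d.k := by
      refine ⟨(valuation_algebraMap_le_one_iff d.Ω d.k a).mp ?_, fun h0 => x.2.2 (by rw [← ha, h0, map_zero])⟩
      rw [ha]; exact x.2.1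
    exact ⟨⟨a, ha'⟩, Subtype.ext ha⟩
  · rintro ⟨a, rfl⟩ σ
    exact (d.galAct_eq_iff σ _).mpr (σ.commutes (a : d.k))

/-- **(lim-3) the Frobenioid's restriction maps are the action**: along a morphism `G/U → G/V` of `D⊢_v` with point `g·V`,
the field functor's `Ω^V → Ω^U` is `x ↦ g·x` (`fixedHom`), so on `𝒪^▷` the restriction map followed by evaluation at the
universal covering is `galAct g` — the cocone commutes up to the `G_v`-action («natural action by `G = Aut(A)`»).
[cite: Mochizuki2012, II Def 4.9 (i) p.154] -/
theorem galAct_fixedHom {X Y : CosetCat d.Gal} (f : X ⟶ Y) (g : d.Gal)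
    (hg : CosetCat.pt f = (g : d.Gal ⧸ Y.sg.toSubgroup)) (y : d.fixedFld Y) (hy : (y : d.Ω) ∈ intNonzero d.Ω) :
    ((d.fixedHom f y : d.fixedFld X) : d.Ω) = (d.galAct g ⟨y, hy⟩ : intNonzero d.Ω) := by
  rw [d.fixedHom_apply_coe f g hg, coe_galAct_apply]

/-- The units of `𝒪^▷_{K̄_v}` are the elements of valuation `1` (`𝒪^×_{K̄_v}`), and `G_v` preserves them.
[cite: MochizukiFrdII2008, Ex 1.1 (i) p.7] -/
theorem isUnit_galAct_iff (σ : d.Gal) (x : intNonzero d.Ω) : IsUnit (d.galAct σ x) ↔ IsUnit x :=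
  MulEquiv.isUnit_map (d.galAct σ)

/-! ### The `G_v`-monoid `𝒪^×_{K̄_v}·q̲^ℕ` of `C⊢_v` -/

/-- `q ∈ 𝒪^▷_{K_v}` read in `𝒪^▷_{K̄_v}`. [cite: Mochizuki2012, I Ex 3.2 (iv) p.71] -/
abbrev toΩ (q : intNonzero d.k) : intNonzero d.Ω := intNonzeroMap d.Ω d.k q

/-- `q̲` (from `K_v`) is `G_v`-invariant. [cite: Mochizuki2012, I Ex 3.2 (iv) p.71] -/
@[simp] theorem galAct_toΩ (σ : d.Gal) (q : intNonzero d.k) : d.galAct σ (d.toΩ q) = d.toΩ q :=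
  (d.galAct_eq_iff σ _).mpr (σ.commutes (q : d.k))

/-- **`𝒪^×_{K̄_v}·q^ℕ ⊆ 𝒪^▷_{K̄_v}`**: the elements `u·q^n`, `u` a unit, `n ∈ ℕ` — the monoid «`𝒪^▷(−) = 𝒪^×(−)·q̲^ℕ`» of the
monogenic Frobenioid `C⊢_v` (`Φ_{C⊢_v} = ℕ·log_Φ(q̲_v)`) evaluated at the universal covering.
[cite: Mochizuki2012, I Ex 3.2 (iv)(v) pp.71-72] -/
def dashCovering (q : intNonzero d.k) : Submonoid ↥(intNonzero d.Ω) where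
  carrier := {x | ∃ n : ℕ, ∃ u : intNonzero d.Ω, IsUnit u ∧ x = u * d.toΩ q ^ n}
  one_mem' := ⟨0, 1, isUnit_one, by rw [pow_zero, mul_one]⟩
  mul_mem' := by
    rintro x y ⟨m, u, hu, rfl⟩ ⟨n, u', hu', rfl⟩
    exact ⟨m + n, u * u', hu.mul hu', by rw [pow_add, mul_mul_mul_comm]⟩

/-- Membership in `𝒪^×·q^ℕ`. [cite: Mochizuki2012, I Ex 3.2 (iv) p.71] -/
theorem mem_dashCovering_iff (q : intNonzero d.k) (x : intNonzero d.Ω) :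
    x ∈ d.dashCovering q ↔ ∃ n : ℕ, ∃ u : intNonzero d.Ω, IsUnit u ∧ x = u * d.toΩ q ^ n := Iff.rfl

/-- `q̲ ∈ 𝒪^×·q̲^ℕ`. [cite: Mochizuki2012, I Ex 3.2 (iv) p.71] -/
theorem toΩ_mem_dashCovering (q : intNonzero d.k) : d.toΩ q ∈ d.dashCovering q :=
  ⟨1, 1, isUnit_one, by rw [pow_one, one_mul]⟩

/-- Units lie in `𝒪^×·q̲^ℕ`. [cite: Mochizuki2012, I Ex 3.2 (iv) p.71] -/
theorem mem_dashCovering_of_isUnit (q : intNonzero d.k) {u : intNonzero d.Ω} (hu : IsUnit u) : u ∈ d.dashCovering q :=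
  ⟨0, u, hu, by rw [pow_zero, mul_one]⟩

/-- **`𝒪^×·q̲^ℕ` is `G_v`-STABLE** (`σ(u·q̲^n) = σ(u)·q̲^n`, `σ(u)` a unit). [cite: Mochizuki2012, II Def 4.9 (i) p.154] -/
theorem galAct_mem_dashCovering (q : intNonzero d.k) (σ : d.Gal) {x : intNonzero d.Ω} (hx : x ∈ d.dashCovering q) :
    d.galAct σ x ∈ d.dashCovering q := by
  obtain ⟨n, u, hu, rfl⟩ := hx
  exact ⟨n, d.galAct σ u, (d.isUnit_galAct_iff σ u).mpr hu, by rw [map_mul, map_pow, galAct_toΩ]⟩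

/-- The `G_v`-action restricted to `𝒪^×·q̲^ℕ`, one `σ` at a time. [cite: Mochizuki2012, II Def 4.9 (i) p.154] -/
def dashActAut (q : intNonzero d.k) (σ : d.Gal) : MulAut ↥(d.dashCovering q) where
  toFun x := ⟨d.galAct σ x, d.galAct_mem_dashCovering q σ x.2⟩
  invFun x := ⟨d.galAct σ⁻¹ x, d.galAct_mem_dashCovering q σ⁻¹ x.2⟩
  left_inv x := Subtype.ext (by
    change d.galAct σ⁻¹ (d.galAct σ x) = x
    rw [← MulAut.mul_apply, ← map_mul, inv_mul_cancel, map_one, MulAut.one_apply])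
  right_inv x := Subtype.ext (by
    change d.galAct σ (d.galAct σ⁻¹ x) = x
    rw [← MulAut.mul_apply, ← map_mul, mul_inv_cancel, map_one, MulAut.one_apply])
  map_mul' x y := Subtype.ext (map_mul (d.galAct σ) _ _)

/-- **`G_v →* Aut(𝒪^×_{K̄_v}·q̲^ℕ)`**. [cite: Mochizuki2012, II Def 4.9 (i) p.154] -/
def dashAct (q : intNonzero d.k) : d.Gal →* MulAut ↥(d.dashCovering q) where
  toFun := d.dashActAut q
  map_one' := MulEquiv.ext fun x => Subtype.ext (by
    change d.galAct 1 x = x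
    rw [map_one, MulAut.one_apply])
  map_mul' σ τ := MulEquiv.ext fun x => Subtype.ext (by
    change d.galAct (σ * τ) x = d.galAct σ (d.galAct τ x)
    rw [map_mul, MulAut.mul_apply])

/-- Values of `dashAct` in `Ω`. [cite: Mochizuki2012, II Def 4.9 (i) p.154] -/
@[simp] theorem coe_dashAct_apply (q : intNonzero d.k) (σ : d.Gal) (x : d.dashCovering q) :
    (((d.dashAct q σ x : d.dashCovering q) : intNonzero d.Ω) : d.Ω) = σ x := rfl

/-- **The `G_v`-monoid `𝒪^×_{K̄_v}·q̲^ℕ` of the GENUINE `C⊢_v`** as a [IUTchII] Def. 4.9 (i) `CoveringMonoid G_v`.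
[cite: Mochizuki2012, II Def 4.9 (i) p.154] -/
def dashCoveringMonoid (q : intNonzero d.k) : CoveringMonoid.{u, u} d.Gal where
  O := ↥(d.dashCovering q)
  act := d.dashAct q

/-- `𝒪^×·q̲^ℕ → 𝒪^▷_{K̄_v}`, the `G_v`-equivariant inclusion («`C⊢_v ⊆ C_v`» on monoids).
[cite: Mochizuki2012, I Ex 3.2 (iv) p.71] -/
theorem dashCovering_subtype_galAct (q : intNonzero d.k) (σ : d.Gal) (x : d.dashCovering q) :
    (d.dashCovering q).subtype (d.dashAct q σ x) = d.galAct σ ((d.dashCovering q).subtype x) := rfl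

/-- A unit `q` gives the unit group: if `q̲` is NOT a unit of `𝒪^▷_{K_v}` then `q̲` is not a unit of `𝒪^▷_{K̄_v}` either
(the valuation of `Ω` extends that of `K_v`), so `𝒪^×·q̲^ℕ` is strictly bigger than `𝒪^×`.
[cite: Mochizuki2012, I Ex 3.2 (iv) p.71] -/
theorem not_isUnit_toΩ {q : intNonzero d.k} (hq : ¬ IsUnit q) : ¬ IsUnit (d.toΩ q) := fun h => hq (by
  rw [isUnit_intNonzero_iff] at h ⊢
  exact (valuation_algebraMap_eq_one_iff d.Ω d.k (q : d.k)).mp h)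

end GaloisValDatum

/-! ### At the genuine datum: the `Gal(K̄_w/K_w)`-monoids of `C⊢_v̲` and of its hull -/

namespace InitialThetaData

variable {F K Fbar : Type} [Field F] [NumberField F] [Field K] [NumberField K] [Algebra F K]
  [Field Fbar] [Algebra F Fbar] [Algebra K Fbar] [IsScalarTower F K Fbar] {E : WeierstrassCurve F}
  [E.IsElliptic] {l : ℕ} {Pb : BadPlacePredicates K} (D : InitialThetaData F K Fbar E l Pb)
  {v : FinitePlace F} (hv : v ∈ D.VFbad) (w : HeightOneSpectrum (𝓞 K)) [w.asIdeal.LiesOver v.maximalIdeal.asIdeal]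
  (p : ℕ) [Fact p.Prime] (hw : ((p : ℕ) : 𝓞 K) ∈ w.asIdeal)

/-- **The `G_v̲`-monoid of the GENUINE `C⊢_v̲`**: `𝒪^×_{K̄_w}·q̲_v̲^ℕ ↶ Gal(K̄_w/K_w)` for initial Θ-data `D` at `v̲ = w ∣ v ∈
V(F)^bad` — the monoid `𝒪^▷(−)` of `D.badCdashAt hv w p hw` (`Φ_{C⊢_v̲} = ℕ·log_Φ(q̲_v̲)`) evaluated at the universal
covering pro-object of `D⊢_v̲ = B(K_v̲)⁰`, as a [IUTchII] Def. 4.9 (i) `CoveringMonoid`.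
[cite: Mochizuki2012, I Ex 3.2 (iv) p.71] -/
abbrev badCoveringMonoidAt : CoveringMonoid.{0, 0} (GaloisValDatum.ofPlace K p w hw).Gal :=
  (GaloisValDatum.ofPlace K p w hw).dashCoveringMonoid (D.qRootAt hv w p hw)

/-- **The `G_v̲`-monoid of the hull `C_v̲`**: `𝒪^▷_{K̄_w} ↶ Gal(K̄_w/K_w)` (depends only on `K_w`).
[cite: Mochizuki2012, I Ex 3.2 (iii) p.71] -/
abbrev badHullCoveringMonoidAt : CoveringMonoid.{0, 0} (GaloisValDatum.ofPlace K p w hw).Gal :=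
  (GaloisValDatum.ofPlace K p w hw).coveringMonoid

/-- **`q̲_v̲ ∈ 𝒪^▷_{C⊢_v̲}(Ã)`**: the genuine `2l`-th root of the Tate parameter lies in the covering monoid of `C⊢_v̲`.
[cite: Mochizuki2012, I Ex 3.2 (iv) p.71] -/
theorem qRootAt_mem_badCoveringMonoidAt :
    (GaloisValDatum.ofPlace K p w hw).toΩ (D.qRootAt hv w p hw) ∈
      (GaloisValDatum.ofPlace K p w hw).dashCovering (D.qRootAt hv w p hw) :=
  GaloisValDatum.toΩ_mem_dashCovering _ _

/-- **`q̲_v̲` is `G_v̲`-invariant** in `𝒪^▷_{K̄_w}`. [cite: Mochizuki2012, I Ex 3.2 (iv) p.71] -/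
theorem galAct_qRootAt (σ : (GaloisValDatum.ofPlace K p w hw).Gal) :
    (GaloisValDatum.ofPlace K p w hw).galAct σ ((GaloisValDatum.ofPlace K p w hw).toΩ (D.qRootAt hv w p hw)) =
      (GaloisValDatum.ofPlace K p w hw).toΩ (D.qRootAt hv w p hw) :=
  GaloisValDatum.galAct_toΩ _ σ _

/-- `q̲_v̲` is NOT a unit of `𝒪^▷_{K̄_w}` (`v(q̲_v̲) < 1`): the covering monoid of `C⊢_v̲` is strictly bigger than `𝒪^×_{K̄_w}`.
[cite: Mochizuki2012, I Ex 3.2 (iv) p.71] -/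
theorem not_isUnit_toΩ_qRootAt :
    ¬ IsUnit ((GaloisValDatum.ofPlace K p w hw).toΩ (D.qRootAt hv w p hw)) :=
  GaloisValDatum.not_isUnit_toΩ _ (D.qRootAt_not_isUnit hv w p hw)

end InitialThetaData

end Literature.IUT.HodgeTheaters

end
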